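import Mathlib.LinearAlgebra.Matrix.PosDef
import Literature.NumberTheory.LFunctions.PsdDyadicCertificate
import Literature.Computation.Certificates.Data
import HarnessLib

/-!
# Kernel lane of the `psd-chol-residual/1` certificate kind on LIST data (one `decide +kernel` per matrix)

Topic `Literature/Computation/Certificates`; sibling of `DyadicCholResidualWitness` (the abstract theorem) and of
`ConicCertificateLayout` (`posSemidef_sub_of_rowSums`, the same statement on `!![…]`/`Fintype` data, which the
elaborator carries to `n ≈ 32`).  This file CITES — and restates nothing of — the list-based, packed, structurally
recursive checker of the Weil-positivity programme, `Literature.NumberTheory.LFunctions.PsdDyadic.checkPsdMid` with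
its soundness theorem `psd_of_checkPsdMid` (the perturbation form of [cite: Rump2006, §2]: integer midpoints `mid`,
budget `δ`, radius `ρ`, an untrusted integer lower factor `C̃` of `mid − δ·1`; the kernel checks
`Σ_j (|mid i j − (δ·1 + C̃C̃ᵀ) i j| + ρ) ≤ δ` row by row; measured there at `≈ 7·10⁻⁵·n³` s per `decide +kernel`,
row bands beyond `n ≈ 150`), and specialises it to EXACT data (`ρ = 0`):

a `psd-chol-residual/1` certificate for the rational matrix `M = N/den` (integer rows `N`, one denominator) with
integer scale `sA = t²d/den`, integer shift `tσ`, integer factor `R` and row-sum bound `r` of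
`E = sA·N − tσ·1 − RRᵀ` is EXACTLY the datum `mid := sA·N − (tσ − r)·1`, `δ := r`, `ρ := 0`, `C̃ := R` of that
checker, because `mid − (δ·1 + RRᵀ) = E`.  Hence (`posSemidef_of_checkCert`)

  `checkCert n den sA q r N R = true  ⟹  (N/den − (q/(sA·den))·1 ⪰ 0` over `ℝ`,  `q = tσ − r`,

i.e. `M − floor·1 ⪰ 0` with the certificate's `floor = (tσ − r)/(t²d)` [cite: Rump1999VerifiedLargeSystems, §4 eq.
after (12) and Algorithm 4.1 step 7 (PDF p. 243)].  The data enter as `List (List ℤ)` (rows; the producer may pack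
them with `PsdDyadic.unpackSq` / `unpackTri`), so elaboration is linear in the file size and the `O(n³)` work is kernel
arithmetic.  Own list bookkeeping only (`midRow`, `midRowsFrom`, `certMidRows`, their private length/entry lemmas, and a
private re-proof of the 5-line `allBelowN` unpacking that is private upstream).  No named fact, no instance, no `sorry`.
-/

open Finset Matrix
open scoped BigOperators

namespace Literature.Computation.Certificates.DyadicCholResidualKernel

open Literature.NumberTheory.LFunctions
open Literature.NumberTheory.LFunctions.PsdDyadic (getMZ checkPsdMid allBelowN symmCheck)

/-! ## The exact midpoint rows `sA·N − q·1` (structural recursion; reduces well in the kernel) -/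

/-- Row `i` of the integer matrix `sA·N − q·1`, from row `i` of `N` read from column `j` on. [folklore] -/
def midRow (sA q : ℤ) (i : ℕ) : ℕ → List ℤ → List ℤ
  | _, [] => []
  | j, x :: xs => (sA * x - if j = i then q else 0) :: midRow sA q i (j + 1) xs

/-- Rows `i, i+1, …` of `sA·N − q·1` from the corresponding rows of `N`. [folklore] -/
def midRowsFrom (sA q : ℤ) : ℕ → List (List ℤ) → List (List ℤ)
  | _, [] => []
  | i, r :: rs => midRow sA q i 0 r :: midRowsFrom sA q (i + 1) rs

/-- The integer midpoint rows `mid = sA·N − q·1` handed to `PsdDyadic.checkPsdMid` (for a `psd-chol-residual/1`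
certificate: `sA = t²d/den`, `q = tσ − r`). [folklore] -/
def certMidRows (sA q : ℤ) (N : List (List ℤ)) : List (List ℤ) := midRowsFrom sA q 0 N

/-- **The kernel check of a `psd-chol-residual/1` certificate on list data**: `0 < den`, `0 < sA`, and the RH-programme
checker `PsdDyadic.checkPsdMid n r 0 (sA·N − q·1) R` (shapes, symmetry, and every row budget
`Σ_j |(sA·N − q·1 − r·1 − RRᵀ) i j| ≤ r`). [folklore] -/
def checkCert (n den sA : ℕ) (q r : ℤ) (N R : List (List ℤ)) : Bool :=
  decide (0 < den) && decide (0 < sA) && checkPsdMid n r 0 (certMidRows sA q N) R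

/-! ## Bookkeeping: lengths and entries of the midpoint rows -/

/-- `midRow` preserves the length. [folklore] -/
private theorem length_midRow (sA q : ℤ) (i : ℕ) : ∀ (j : ℕ) (r : List ℤ), (midRow sA q i j r).length = r.length
  | _, [] => rfl
  | j, _ :: xs => by simp [midRow, length_midRow sA q i (j + 1) xs]

/-- Entry `k` of `midRow … j r` is `sA·r_k − q·[j + k = i]`. [folklore] -/
private theorem getD_midRow (sA q : ℤ) (i : ℕ) : ∀ (r : List ℤ) (j k : ℕ), k < r.length →
    (midRow sA q i j r).getD k 0 = sA * r.getD k 0 - if j + k = i then q else 0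
  | [], _, _, hk => absurd hk (Nat.not_lt_zero _)
  | x :: xs, j, 0, _ => by simp [midRow]
  | x :: xs, j, k + 1, hk => by
      have hk' : k < xs.length := by simpa using hk
      simp only [midRow, List.getD_cons_succ]
      rw [getD_midRow sA q i xs (j + 1) k hk', show j + 1 + k = j + (k + 1) by omega]

/-- `midRowsFrom` preserves the number of rows. [folklore] -/
private theorem length_midRowsFrom (sA q : ℤ) : ∀ (i : ℕ) (N : List (List ℤ)), (midRowsFrom sA q i N).length = N.length
  | _, [] => rfl
  | i, _ :: rs => by simp [midRowsFrom, length_midRowsFrom sA q (i + 1) rs]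

/-- Row `t` of `midRowsFrom … i N` is `midRow … (i + t) 0 (N_t)`. [folklore] -/
private theorem getD_midRowsFrom (sA q : ℤ) : ∀ (N : List (List ℤ)) (i t : ℕ), t < N.length →
    (midRowsFrom sA q i N).getD t [] = midRow sA q (i + t) 0 (N.getD t [])
  | [], _, _, ht => absurd ht (Nat.not_lt_zero _)
  | r :: rs, i, 0, _ => by simp [midRowsFrom]
  | r :: rs, i, t + 1, ht => by
      have ht' : t < rs.length := by simpa using ht
      simp only [midRowsFrom, List.getD_cons_succ]
      rw [getD_midRowsFrom sA q rs (i + 1) t ht', show i + 1 + t = i + (t + 1) by omega]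

/-- `certMidRows` has as many rows as `N`. [folklore] -/
private theorem length_certMidRows (sA q : ℤ) (N : List (List ℤ)) : (certMidRows sA q N).length = N.length :=
  length_midRowsFrom sA q 0 N

/-- Row `t` of `certMidRows` has the length of row `t` of `N`. [folklore] -/
private theorem length_getD_certMidRows (sA q : ℤ) (N : List (List ℤ)) {t : ℕ} (ht : t < N.length) :
    ((certMidRows sA q N).getD t []).length = (N.getD t []).length := by
  rw [certMidRows, getD_midRowsFrom sA q N 0 t ht, length_midRow]

/-- The entries of the midpoint rows: `mid i j = sA·N i j − q·[i = j]` inside the stored rows. [folklore] -/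
private theorem getMZ_certMidRows {sA q : ℤ} {N : List (List ℤ)} {i j : ℕ} (hi : i < N.length)
    (hj : j < (N.getD i []).length) :
    getMZ (certMidRows sA q N) i j = sA * getMZ N i j - if i = j then q else 0 := by
  unfold PsdDyadic.getMZ
  rw [certMidRows, getD_midRowsFrom sA q N 0 i hi, Nat.zero_add, getD_midRow sA q i _ 0 j hj, Nat.zero_add]
  by_cases h : i = j
  · simp [h]
  · simp [h, Ne.symm h]

/-! ## Unpacking `checkPsdMid` (the upstream lemma is private; re-proved here for the parts used) -/

/-- `∀ k < n, P k` from `allBelowN`. [folklore] -/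
private theorem of_allBelowN {n : ℕ} {P : ℕ → Bool} (h : allBelowN n P = true) {k : ℕ} (hk : k < n) :
    P k = true := by
  induction n with
  | zero => exact absurd hk (Nat.not_lt_zero _)
  | succ n ih =>
    have h' : (allBelowN n P && P n) = true := h
    rw [Bool.and_eq_true] at h'
    rcases Nat.lt_succ_iff_lt_or_eq.1 hk with hk' | rfl
    · exact ih h'.1 hk'
    · exact h'.2

/-- An in-range `getD` is a member. [folklore] -/
private theorem getD_mem {α : Type*} (l : List α) (d : α) {t : ℕ} (ht : t < l.length) : l.getD t d ∈ l := by
  rw [List.getD_eq_getElem?_getD, List.getElem?_eq_getElem ht, Option.getD_some]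
  exact List.getElem_mem ht

/-- The shape and symmetry facts contained in `checkPsdMid = true`. [folklore] -/
private theorem shape_of_checkPsdMid {n : ℕ} {δ ρ : ℤ} {mid L : List (List ℤ)}
    (h : checkPsdMid n δ ρ mid L = true) :
    mid.length = n ∧ (∀ r ∈ mid, r.length = n) ∧
      ∀ i j : ℕ, j < i → i < n → getMZ mid i j = getMZ mid j i := by
  unfold PsdDyadic.checkPsdMid at h
  simp only [Bool.and_eq_true, decide_eq_true_eq, List.all_eq_true] at h
  obtain ⟨⟨⟨⟨⟨hml, -⟩, hmr⟩, -⟩, hsy⟩, -⟩ := h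
  refine ⟨hml, hmr, fun i j hji hin => ?_⟩
  unfold PsdDyadic.symmCheck at hsy
  have h1 := of_allBelowN hsy hin
  have h2 := of_allBelowN h1 hji
  simpa using h2

/-! ## Soundness -/

/-- **Soundness of the kernel check of a `psd-chol-residual/1` certificate (list data)**: if
`checkCert n den sA q r N R = true` then `N/den − (q/(sA·den))·1` is positive semidefinite over `ℝ` — with
`sA = t²d/den` and `q = tσ − r` this is `M − ((tσ − r)/(t²d))·1 ⪰ 0`, Rump's `λ_min(A − sI) ≥ −‖Δ‖` rescaled, decided
by the RH programme's `PsdDyadic.checkPsdMid` with `ρ = 0`, `δ = r`, `mid = sA·N − q·1`.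
[cite: Rump1999VerifiedLargeSystems, §4 eq. after (12) and Algorithm 4.1 step 7 (PDF p. 243)] -/
theorem posSemidef_of_checkCert {n den sA : ℕ} {q r : ℤ} {N R : List (List ℤ)}
    (h : checkCert n den sA q r N R = true) :
    ((matrixOfRows n n N).map (fun z : ℤ => (z : ℝ) / den) -
      ((q : ℝ) / ((sA : ℝ) * den)) • (1 : Matrix (Fin n) (Fin n) ℝ)).PosSemidef := by
  have h' : 0 < den ∧ 0 < sA ∧ checkPsdMid n r 0 (certMidRows sA q N) R = true := by
    simpa [checkCert, Bool.and_eq_true, decide_eq_true_eq, and_assoc] using h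
  obtain ⟨hden, hsA, hmid⟩ := h'
  obtain ⟨hml, hmr, hsy⟩ := shape_of_checkPsdMid hmid
  have hNl : N.length = n := by rw [← hml, length_certMidRows]
  have hNr : ∀ t, t < n → (N.getD t []).length = n := fun t ht => by
    have hmem : (certMidRows sA q N).getD t [] ∈ certMidRows sA q N :=
      getD_mem _ _ (by rw [hml]; exact ht)
    have hl := hmr _ hmem
    rwa [length_getD_certMidRows sA q N (hNl.symm ▸ ht)] at hl
  -- entries of `mid`
  have hent : ∀ i j : Fin n, (getMZ (certMidRows sA q N) i j : ℝ) =
      (sA : ℝ) * (getMZ N i j : ℝ) - if (i : ℕ) = (j : ℕ) then (q : ℝ) else 0 := by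
    intro i j
    rw [getMZ_certMidRows (hNl.symm ▸ i.isLt) (by rw [hNr i i.isLt]; exact j.isLt)]
    push_cast
    split_ifs <;> simp
  -- the RH checker's conclusion for `M' = mid · u`, `u = 1/(sA·den)`
  set u : ℝ := ((sA : ℝ) * den)⁻¹ with hu_def
  have hsA' : (0 : ℝ) < sA := by exact_mod_cast hsA
  have hden' : (0 : ℝ) < den := by exact_mod_cast hden
  have hu : 0 < u := by rw [hu_def]; positivity
  set M' : Fin n → Fin n → ℝ := fun i j => (getMZ (certMidRows sA q N) i j : ℝ) * u with hM'_def
  have hquad : ∀ α : Fin n → ℝ, 0 ≤ ∑ i, ∑ j, α i * α j * M' i j := fun α =>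
    PsdDyadic.psd_of_checkPsdMid hmid hu M' (fun i j => by simp [hM'_def]) α
  -- the target matrix IS `M'`
  have hA : ∀ i j : Fin n, ((matrixOfRows n n N).map (fun z : ℤ => (z : ℝ) / den) -
      ((q : ℝ) / ((sA : ℝ) * den)) • (1 : Matrix (Fin n) (Fin n) ℝ)) i j = M' i j := by
    intro i j
    have hsA0 : (sA : ℝ) ≠ 0 := ne_of_gt hsA'
    have hden0 : (den : ℝ) ≠ 0 := ne_of_gt hden'
    have hM'ij : M' i j =
        ((sA : ℝ) * (getMZ N i j : ℝ) - if (i : ℕ) = (j : ℕ) then (q : ℝ) else 0) * ((sA : ℝ) * den)⁻¹ := by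
      simp only [hM'_def]
      rw [hent]
    rw [hM'ij]
    simp only [Matrix.sub_apply, Matrix.map_apply, matrixOfRows_apply, Matrix.smul_apply, Matrix.one_apply,
      smul_eq_mul, PsdDyadic.getMZ]
    by_cases hij : i = j
    · subst hij
      rw [if_pos rfl, if_pos rfl, mul_one]
      field_simp
    · have hij' : (i : ℕ) ≠ (j : ℕ) := fun e => hij (Fin.ext e)
      rw [if_neg hij, if_neg hij', mul_zero, sub_zero, sub_zero]
      field_simp
  -- symmetry of the target (from the kernel's symmetry check of `mid`)
  have hsymm : ∀ i j : Fin n, M' j i = M' i j := by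
    intro i j
    simp only [hM'_def]
    congr 1
    rcases lt_trichotomy (i : ℕ) (j : ℕ) with hlt | heq | hgt
    · exact_mod_cast hsy j i hlt j.isLt
    · rw [Fin.ext heq]
    · exact_mod_cast (hsy i j hgt i.isLt).symm
  refine Matrix.PosSemidef.of_dotProduct_mulVec_nonneg ?_ fun x => ?_
  · rw [Matrix.isHermitian_iff_isSymm]
    exact Matrix.IsSymm.ext fun i j => by rw [hA, hA, hsymm]
  · have hq := hquad x
    have hform : star x ⬝ᵥ (((matrixOfRows n n N).map (fun z : ℤ => (z : ℝ) / den) -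
        ((q : ℝ) / ((sA : ℝ) * den)) • (1 : Matrix (Fin n) (Fin n) ℝ)) *ᵥ x) =
        ∑ i, ∑ j, x i * x j * M' i j := by
      simp only [star_trivial, dotProduct, Matrix.mulVec, Finset.mul_sum]
      refine Finset.sum_congr rfl fun i _ => Finset.sum_congr rfl fun j _ => ?_
      rw [hA i j]
      ring
    rw [hform]
    exact hq

/-- **Quadratic-form version** (no matrix vocabulary): under the same check,
`0 ≤ Σ_i Σ_j x_i x_j (N i j/den − (q/(sA·den))·[i = j])` for every real vector `x`.
[cite: Rump1999VerifiedLargeSystems, §4 eq. after (12) and Algorithm 4.1 step 7 (PDF p. 243)] -/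
theorem quadForm_nonneg_of_checkCert {n den sA : ℕ} {q r : ℤ} {N R : List (List ℤ)}
    (h : checkCert n den sA q r N R = true) (x : Fin n → ℝ) :
    0 ≤ ∑ i, ∑ j : Fin n, x i * x j *
      (((N.getD i []).getD j 0 : ℝ) / den - if i = j then (q : ℝ) / ((sA : ℝ) * den) else 0) := by
  have hP := (posSemidef_of_checkCert h).dotProduct_mulVec_nonneg x
  have hform : star x ⬝ᵥ (((matrixOfRows n n N).map (fun z : ℤ => (z : ℝ) / den) -
      ((q : ℝ) / ((sA : ℝ) * den)) • (1 : Matrix (Fin n) (Fin n) ℝ)) *ᵥ x) =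
      ∑ i, ∑ j : Fin n, x i * x j *
        (((N.getD i []).getD j 0 : ℝ) / den - if i = j then (q : ℝ) / ((sA : ℝ) * den) else 0) := by
    simp only [star_trivial, dotProduct, Matrix.mulVec, Finset.mul_sum, Matrix.sub_apply, Matrix.map_apply,
      matrixOfRows_apply, Matrix.smul_apply, Matrix.one_apply, smul_eq_mul, mul_ite, mul_one, mul_zero]
    refine Finset.sum_congr rfl fun i _ => Finset.sum_congr rfl fun j _ => ?_
    ring
  rw [hform] at hP
  exact hP

/-! ## Test (kernel-checked): eng-cap-2's G9 MF-1 witness twin, `n = 3` -/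

/-- Test: the int64-range twin of the `cap.ila.psd` G9 witness — `N = [[2^62,0,0],[0,2^60,2^61],[0,2^61,2^60]]`,
`den = 1`, `sA = 4` (`t = 2`, `d = 1`), `σ = 0`, `r = 2^64` (`q = tσ − r = −2^64`), `R = [[2^32],[2^31,0],[2^31,0,0]]`:
the check passes in the kernel (four residual entries are exactly `−2^63`). -/
example : checkCert 3 1 4 (-18446744073709551616) 18446744073709551616
    [[4611686018427387904, 0, 0], [0, 1152921504606846976, 2305843009213693952],
      [0, 2305843009213693952, 1152921504606846976]]
    [[4294967296], [2147483648, 0], [2147483648, 0, 0]] = true := by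
  decide +kernel

end Literature.Computation.Certificates.DyadicCholResidualKernel

/-! ## Row bands (appended 2026-08-27, certnum-ila-3 gen 2): one `decide +kernel` per band DECLARATION, reassembled

For `n ≳ 100` the single `decide` on `checkCert` exceeds the per-declaration heartbeat budget of the farm (measured: `n = 120`
at `t_bits = 32` stops with `whnf` heartbeats after 177 s; `n = 64` passes in 25 s).  `PsdDyadic.checkPsdMid` is row-separable
into the data-only part `PsdDyadic.checkPsdShape` (lengths + symmetry) and one `PsdDyadic.checkPsdBand δ ρ mid L i₀ k` per band of
rows `i₀ ≤ t < i₀ + k` — each its own theorem in the SAME instance file, since the budget is per declaration — which reassemble to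
the monolithic check.  The reassembly bookkeeping below is the one of the RH programme's helper
`Summits/RiemannHypothesis/RiemannHypothesis/Theorems/FormatCPsdBands.lean` (weil-2; not importable from `Literature/`), re-proved
here privately; the public statement `posSemidef_of_bands` is the banded form of `posSemidef_of_checkCert`. -/

namespace Literature.Computation.Certificates.DyadicCholResidualKernel

open Literature.NumberTheory.LFunctions
open Literature.NumberTheory.LFunctions.PsdDyadic

/-- What `checkRowsMid` certifies: equal lengths and every row budget (offset form). [folklore] -/
private theorem checkRowsMid_spec (δ ρ : ℤ) (rows : List (List ℤ)) : ∀ (ms ris : List (List ℤ)) (i₀ : ℕ),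
    checkRowsMid δ ρ rows i₀ ms ris = true →
    ms.length = ris.length ∧ ∀ t < ms.length, rowErrSumMid δ ρ (ris.getD t []) (i₀ + t) 0 (ms.getD t []) rows ≤ δ
  | [], [], _, _ => ⟨rfl, fun t ht ↦ absurd ht (Nat.not_lt_zero _)⟩
  | [], _ :: _, _, h => by simp [checkRowsMid] at h
  | _ :: _, [], _, h => by simp [checkRowsMid] at h
  | mi :: ms, ri :: ris, i₀, h => by
      rw [checkRowsMid, Bool.and_eq_true, decide_eq_true_eq] at h
      obtain ⟨hlen, hrest⟩ := checkRowsMid_spec δ ρ rows ms ris (i₀ + 1) h.2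
      refine ⟨by simp [hlen], fun t ht ↦ ?_⟩
      cases t with
      | zero => simpa using h.1
      | succ t =>
        have := hrest t (by simpa using ht)
        simpa [List.getD_cons_succ, show i₀ + 1 + t = i₀ + (t + 1) by omega] using this

/-- Converse: equal lengths and all row budgets give the Boolean check. [folklore] -/
private theorem checkRowsMid_of_rows (δ ρ : ℤ) (rows : List (List ℤ)) : ∀ (ms ris : List (List ℤ)) (i₀ : ℕ),
    ms.length = ris.length →
    (∀ t < ms.length, rowErrSumMid δ ρ (ris.getD t []) (i₀ + t) 0 (ms.getD t []) rows ≤ δ) →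
    checkRowsMid δ ρ rows i₀ ms ris = true
  | [], [], _, _, _ => rfl
  | [], _ :: _, _, h, _ => by simp at h
  | _ :: _, [], _, h, _ => by simp at h
  | mi :: ms, ri :: ris, i₀, h, hr => by
      rw [checkRowsMid, Bool.and_eq_true, decide_eq_true_eq]
      refine ⟨by simpa using hr 0 (by simp), checkRowsMid_of_rows δ ρ rows ms ris (i₀ + 1) (by simpa using h) fun t ht ↦ ?_⟩
      have := hr (t + 1) (by simpa using ht)
      simpa [List.getD_cons_succ, show i₀ + (t + 1) = i₀ + 1 + t by omega] using this

/-- A band certifies its rows: `checkPsdBand δ ρ mid L i₀ k = true` gives the budget of every row `i₀ ≤ t < i₀ + k`,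
`t < mid.length`. [folklore] -/
private theorem rowBudget_of_checkPsdBand {δ ρ : ℤ} {mid L : List (List ℤ)} {i₀ k : ℕ}
    (h : checkPsdBand δ ρ mid L i₀ k = true) {t : ℕ} (h₁ : i₀ ≤ t) (h₂ : t < i₀ + k) (h₃ : t < mid.length) :
    rowErrSumMid δ ρ (L.getD t []) t 0 (mid.getD t []) L ≤ δ := by
  obtain ⟨-, hrows⟩ := checkRowsMid_spec δ ρ L _ _ i₀ h
  obtain ⟨s, rfl⟩ : ∃ s, t = i₀ + s := ⟨t - i₀, by omega⟩
  have hs : s < k := by omega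
  have hsm : s < ((mid.drop i₀).take k).length := by simp; omega
  have key := hrows s hsm
  have hm : ((mid.drop i₀).take k).getD s [] = mid.getD (i₀ + s) [] := by
    rw [List.getD_eq_getElem?_getD, List.getD_eq_getElem?_getD, List.getElem?_take_of_lt hs, List.getElem?_drop]
  have hL : ((L.drop i₀).take k).getD s [] = L.getD (i₀ + s) [] := by
    rw [List.getD_eq_getElem?_getD, List.getD_eq_getElem?_getD, List.getElem?_take_of_lt hs, List.getElem?_drop]
  rwa [hm, hL] at key

/-- Reassembly: shapes + every row budget give the monolithic check `checkPsdMid`. [folklore] -/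
private theorem checkPsdMid_of_bands {n : ℕ} {δ ρ : ℤ} {mid L : List (List ℤ)} (hs : checkPsdShape n mid L = true)
    (hr : ∀ t < n, rowErrSumMid δ ρ (L.getD t []) t 0 (mid.getD t []) L ≤ δ) : checkPsdMid n δ ρ mid L = true := by
  unfold checkPsdShape at hs
  simp only [Bool.and_eq_true, decide_eq_true_eq] at hs
  obtain ⟨⟨⟨⟨hml, hLl⟩, hmr⟩, hLr⟩, hsy⟩ := hs
  unfold checkPsdMid
  simp only [Bool.and_eq_true, decide_eq_true_eq]
  refine ⟨⟨⟨⟨⟨hml, hLl⟩, hmr⟩, hLr⟩, hsy⟩, ?_⟩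
  exact checkRowsMid_of_rows δ ρ L mid L 0 (by rw [hml, hLl]) fun t ht ↦ by
    simpa using hr t (by rw [← hml]; exact ht)

/-- **Banded kernel check of a `psd-chol-residual/1` certificate ⇒ its conclusion**: with `mid = sA·N − q·1`, if
`PsdDyadic.checkPsdShape n mid R` holds and every row `t < n` lies in SOME accepted band
`PsdDyadic.checkPsdBand r 0 mid R i₀ k` (one `decide +kernel` per band theorem), then `N/den − (q/(sA·den))·1 ⪰ 0` over
`ℝ` — the conclusion of `posSemidef_of_checkCert`, i.e. `M − ((tσ − r)/(t²d))·1 ⪰ 0` for `sA = t²d/den`, `q = tσ − r`.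
[cite: Rump1999VerifiedLargeSystems, §4 eq. after (12) and Algorithm 4.1 step 7 (PDF p. 243)] -/
theorem posSemidef_of_bands {n den sA : ℕ} {q r : ℤ} {N R : List (List ℤ)} (hden : 0 < den) (hsA : 0 < sA)
    (hs : checkPsdShape n (certMidRows sA q N) R = true)
    (hb : ∀ t < n, ∃ i₀ k, checkPsdBand r 0 (certMidRows sA q N) R i₀ k = true ∧ i₀ ≤ t ∧ t < i₀ + k) :
    ((matrixOfRows n n N).map (fun z : ℤ => (z : ℝ) / den) -
      ((q : ℝ) / ((sA : ℝ) * den)) • (1 : Matrix (Fin n) (Fin n) ℝ)).PosSemidef := by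
  have hml : (certMidRows sA q N).length = n := by
    have hs' := hs
    unfold checkPsdShape at hs'
    simp only [Bool.and_eq_true, decide_eq_true_eq] at hs'
    exact hs'.1.1.1.1
  have hmid : checkPsdMid n r 0 (certMidRows sA q N) R = true :=
    checkPsdMid_of_bands hs fun t ht => by
      obtain ⟨i₀, k, hk, h₁, h₂⟩ := hb t ht
      exact rowBudget_of_checkPsdBand hk h₁ h₂ (by rw [hml]; exact ht)
  have hc : checkCert n den sA q r N R = true := by
    unfold checkCert
    simp only [Bool.and_eq_true, decide_eq_true_eq]
    exact ⟨⟨hden, hsA⟩, hmid⟩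
  exact posSemidef_of_checkCert hc

/-- Test (banded form on the `n = 3` twin: bands `{0,1}` and `{2}`, each its own `decide +kernel`). -/
example :
    ((matrixOfRows 3 3 [[4611686018427387904, 0, 0], [0, 1152921504606846976, 2305843009213693952],
        [0, 2305843009213693952, 1152921504606846976]]).map (fun z : ℤ => (z : ℝ) / (1 : ℕ)) -
      (((-18446744073709551616 : ℤ) : ℝ) / (((4 : ℕ) : ℝ) * (1 : ℕ))) • (1 : Matrix (Fin 3) (Fin 3) ℝ)).PosSemidef :=
  posSemidef_of_bands (N := [[4611686018427387904, 0, 0], [0, 1152921504606846976, 2305843009213693952],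
      [0, 2305843009213693952, 1152921504606846976]])
    (R := [[4294967296], [2147483648, 0], [2147483648, 0, 0]]) (r := 18446744073709551616)
    (by decide) (by decide) (by decide +kernel) fun t ht => by
      interval_cases t
      · exact ⟨0, 2, by decide +kernel, by omega, by omega⟩
      · exact ⟨0, 2, by decide +kernel, by omega, by omega⟩
      · exact ⟨2, 1, by decide +kernel, by omega, by omega⟩

end Literature.Computation.Certificates.DyadicCholResidualKernel

/-! ## Ball input (appended 2026-08-27, certnum-ila-3 gen 2): uniform entrywise radius `rad/den`, `ρ = sA·rad`

A `psd-chol-residual/1` certificate for BALL input with a UNIFORM integer radius — every symmetric `A` with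
`|A i j − N i j/den| ≤ rad/den` — folds `sA·rad` per entry into the row sums (`r ≥ Σ_j |E i j| + n·sA·rad`), which is exactly the
`ρ := sA·rad` budget of `PsdDyadic.checkPsdMid` (`Σ_j (|mid i j − P i j| + ρ) ≤ δ`) with the unit `u = 1/(sA·den)`: `ρ·u = rad/den`.  So
the SAME kernel check, now with `ρ = sA·rad`, certifies `A − (q/(sA·den))·1 ⪰ 0` for every symmetric member `A` of the ball — the
kernel form of `DyadicCholResidualWitness.posSemidef_sub_smul_one_of_ball` (Rump's Algorithm 4.1 with the data radii in the residual
budget).  Single-decide and row-band forms. -/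

namespace Literature.Computation.Certificates.DyadicCholResidualKernel

open Literature.NumberTheory.LFunctions
open Literature.NumberTheory.LFunctions.PsdDyadic

/-- **The kernel check of a BALL `psd-chol-residual/1` certificate (uniform radius `rad/den`)**: `0 < den`, `0 < sA`, and
`PsdDyadic.checkPsdMid n r (sA·rad) (sA·N − q·1) R` (every row budget `Σ_j (|E i j| + sA·rad) ≤ r`). [folklore] -/
def checkCertBall (n den sA rad : ℕ) (q r : ℤ) (N R : List (List ℤ)) : Bool :=
  decide (0 < den) && decide (0 < sA) && checkPsdMid n r ((sA : ℤ) * rad) (certMidRows sA q N) R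

/-- From the monolithic midpoint check with radius budget `ρ = sA·rad`: every real symmetric `A` in the entrywise ball of radius
`rad/den` around `N/den` satisfies `A − (q/(sA·den))·1 ⪰ 0` (shared step of the single-decide and banded forms). [folklore] -/
private theorem posSemidef_ball_of_checkPsdMid {n den sA rad : ℕ} {q r : ℤ} {N R : List (List ℤ)} (hden : 0 < den)
    (hsA : 0 < sA) (hmid : checkPsdMid n r ((sA : ℤ) * rad) (certMidRows sA q N) R = true)
    {A : Matrix (Fin n) (Fin n) ℝ} (hA : A.IsSymm)
    (hball : ∀ i j : Fin n, |A i j - ((N.getD i []).getD j 0 : ℝ) / den| ≤ (rad : ℝ) / den) :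
    (A - ((q : ℝ) / ((sA : ℝ) * den)) • (1 : Matrix (Fin n) (Fin n) ℝ)).PosSemidef := by
  obtain ⟨hml, hmr, -⟩ := shape_of_checkPsdMid hmid
  have hNl : N.length = n := by rw [← hml, length_certMidRows]
  have hNr : ∀ t, t < n → (N.getD t []).length = n := fun t ht => by
    have hmem : (certMidRows sA q N).getD t [] ∈ certMidRows sA q N :=
      getD_mem _ _ (by rw [hml]; exact ht)
    have hl := hmr _ hmem
    rwa [length_getD_certMidRows sA q N (hNl.symm ▸ ht)] at hl
  have hent : ∀ i j : Fin n, (getMZ (certMidRows sA q N) i j : ℝ) =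
      (sA : ℝ) * (getMZ N i j : ℝ) - if (i : ℕ) = (j : ℕ) then (q : ℝ) else 0 := by
    intro i j
    rw [getMZ_certMidRows (hNl.symm ▸ i.isLt) (by rw [hNr i i.isLt]; exact j.isLt)]
    push_cast
    split_ifs <;> simp
  set u : ℝ := ((sA : ℝ) * den)⁻¹ with hu_def
  have hsA' : (0 : ℝ) < sA := by exact_mod_cast hsA
  have hden' : (0 : ℝ) < den := by exact_mod_cast hden
  have hsA0 : (sA : ℝ) ≠ 0 := ne_of_gt hsA'
  have hden0 : (den : ℝ) ≠ 0 := ne_of_gt hden'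
  have hu : 0 < u := by rw [hu_def]; positivity
  set M' : Fin n → Fin n → ℝ := fun i j =>
    (A - ((q : ℝ) / ((sA : ℝ) * den)) • (1 : Matrix (Fin n) (Fin n) ℝ)) i j with hM'_def
  -- the enclosure hypothesis of the RH checker: `|M' i j − mid i j · u| ≤ ρ·u` with `ρ = sA·rad`, `ρ·u = rad/den`
  have hM : ∀ i j : Fin n, |M' i j - (getMZ (certMidRows sA q N) i j : ℝ) * u| ≤ (((sA : ℤ) * rad : ℤ) : ℝ) * u := by
    intro i j
    have hrho : (((sA : ℤ) * rad : ℤ) : ℝ) * u = (rad : ℝ) / den := by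
      push_cast
      rw [hu_def]
      field_simp
    have hdiff : M' i j - (getMZ (certMidRows sA q N) i j : ℝ) * u = A i j - ((N.getD i []).getD j 0 : ℝ) / den := by
      rw [hM'_def, hent, hu_def]
      simp only [Matrix.sub_apply, Matrix.smul_apply, Matrix.one_apply, smul_eq_mul, PsdDyadic.getMZ]
      by_cases hij : i = j
      · subst hij
        rw [if_pos rfl, if_pos rfl, mul_one]
        field_simp
        ring
      · have hij' : (i : ℕ) ≠ (j : ℕ) := fun e => hij (Fin.ext e)
        rw [if_neg hij, if_neg hij', mul_zero, sub_zero, sub_zero]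
        field_simp
    rw [hrho, hdiff]
    exact hball i j
  have hquad : ∀ α : Fin n → ℝ, 0 ≤ ∑ i, ∑ j, α i * α j * M' i j := fun α =>
    PsdDyadic.psd_of_checkPsdMid hmid hu M' hM α
  have hsymm : (A - ((q : ℝ) / ((sA : ℝ) * den)) • (1 : Matrix (Fin n) (Fin n) ℝ)).IsSymm := by
    refine Matrix.IsSymm.ext fun i j => ?_
    simp only [Matrix.sub_apply, Matrix.smul_apply, Matrix.one_apply, smul_eq_mul]
    rw [hA.apply i j]
    by_cases hij : i = j
    · subst hij; rfl
    · rw [if_neg hij, if_neg (Ne.symm hij)]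
  refine Matrix.PosSemidef.of_dotProduct_mulVec_nonneg (Matrix.isHermitian_iff_isSymm.2 hsymm) fun x => ?_
  have hform : star x ⬝ᵥ ((A - ((q : ℝ) / ((sA : ℝ) * den)) • (1 : Matrix (Fin n) (Fin n) ℝ)) *ᵥ x) =
      ∑ i, ∑ j, x i * x j * M' i j := by
    simp only [star_trivial, dotProduct, Matrix.mulVec, Finset.mul_sum, hM'_def]
    refine Finset.sum_congr rfl fun i _ => Finset.sum_congr rfl fun j _ => ?_
    ring
  rw [hform]
  exact hquad x

/-- **Soundness of the kernel check of a BALL certificate (uniform radius)**: if `checkCertBall n den sA rad q r N R = true`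
then EVERY real symmetric `A` with `|A i j − N i j/den| ≤ rad/den` satisfies `A − (q/(sA·den))·1 ⪰ 0` — with `sA = t²d/den`,
`q = tσ − r`: `A − ((tσ − r)/(t²d))·1 ⪰ 0` for every member of the ball, Rump's Algorithm 4.1 with the data radii folded into the
residual budget (`Δ` computed in interval arithmetic).
[cite: Rump1999VerifiedLargeSystems, §4 Algorithm 4.1 steps 6–7 (PDF p. 243)] -/
theorem posSemidef_of_checkCertBall {n den sA rad : ℕ} {q r : ℤ} {N R : List (List ℤ)}
    (h : checkCertBall n den sA rad q r N R = true) {A : Matrix (Fin n) (Fin n) ℝ} (hA : A.IsSymm)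
    (hball : ∀ i j : Fin n, |A i j - ((N.getD i []).getD j 0 : ℝ) / den| ≤ (rad : ℝ) / den) :
    (A - ((q : ℝ) / ((sA : ℝ) * den)) • (1 : Matrix (Fin n) (Fin n) ℝ)).PosSemidef := by
  have h' : 0 < den ∧ 0 < sA ∧ checkPsdMid n r ((sA : ℤ) * rad) (certMidRows sA q N) R = true := by
    simpa [checkCertBall, Bool.and_eq_true, decide_eq_true_eq, and_assoc] using h
  exact posSemidef_ball_of_checkPsdMid h'.1 h'.2.1 h'.2.2 hA hball

/-- **Ball certificate, row-band form**: shapes + one accepted band per row (each its own `decide +kernel` declaration) with the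
radius budget `ρ = sA·rad` ⇒ every symmetric member of the ball satisfies `A − (q/(sA·den))·1 ⪰ 0`.
[cite: Rump1999VerifiedLargeSystems, §4 Algorithm 4.1 steps 6–7 (PDF p. 243)] -/
theorem posSemidef_ball_of_bands {n den sA rad : ℕ} {q r : ℤ} {N R : List (List ℤ)} (hden : 0 < den) (hsA : 0 < sA)
    (hs : checkPsdShape n (certMidRows sA q N) R = true)
    (hb : ∀ t < n, ∃ i₀ k, checkPsdBand r ((sA : ℤ) * rad) (certMidRows sA q N) R i₀ k = true ∧ i₀ ≤ t ∧ t < i₀ + k)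
    {A : Matrix (Fin n) (Fin n) ℝ} (hA : A.IsSymm)
    (hball : ∀ i j : Fin n, |A i j - ((N.getD i []).getD j 0 : ℝ) / den| ≤ (rad : ℝ) / den) :
    (A - ((q : ℝ) / ((sA : ℝ) * den)) • (1 : Matrix (Fin n) (Fin n) ℝ)).PosSemidef := by
  have hml : (certMidRows sA q N).length = n := by
    have hs' := hs
    unfold checkPsdShape at hs'
    simp only [Bool.and_eq_true, decide_eq_true_eq] at hs'
    exact hs'.1.1.1.1
  have hmid : checkPsdMid n r ((sA : ℤ) * rad) (certMidRows sA q N) R = true :=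
    checkPsdMid_of_bands hs fun t ht => by
      obtain ⟨i₀, k, hk, h₁, h₂⟩ := hb t ht
      exact rowBudget_of_checkPsdBand hk h₁ h₂ (by rw [hml]; exact ht)
  exact posSemidef_ball_of_checkPsdMid hden hsA hmid hA hball

/-! ### The exact rational member (the usual target: a rational `Q` certified through a dyadic ball around it) -/

/-- Every entry of the rational rows `Q` lies in the ball: `|den·Q i j − N i j| ≤ rad` for all `i, j < n`, and `Q` has `n` rows of
length `n` (a `Bool` of the list data). [folklore] -/
def ballCheckQ (n den rad : ℕ) (Q : List (List ℚ)) (N : List (List ℤ)) : Bool :=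
  decide (Q.length = n) && Q.all (fun row => decide (row.length = n)) &&
    allBelowN n fun i => allBelowN n fun j =>
      decide (|(den : ℚ) * ((Q.getD i []).getD j 0) - (((N.getD i []).getD j 0 : ℤ) : ℚ)| ≤ rad)

/-- Symmetry of the `n × n` part of the rational rows `Q`, by indexed access. [folklore] -/
def symmCheckQ (n : ℕ) (Q : List (List ℚ)) : Bool :=
  allBelowN n fun i => allBelowN i fun j => decide ((Q.getD i []).getD j 0 = (Q.getD j []).getD i 0)

/-- `symmCheckQ` gives a symmetric `matrixOfRows`. [folklore] -/
private theorem isSymm_of_symmCheckQ {n : ℕ} {Q : List (List ℚ)} (h : symmCheckQ n Q = true) :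
    ((matrixOfRows n n Q).map (Rat.cast : ℚ → ℝ)).IsSymm := by
  unfold symmCheckQ at h
  refine Matrix.IsSymm.ext fun i j => ?_
  simp only [Matrix.map_apply, matrixOfRows_apply]
  congr 1
  rcases lt_trichotomy (i : ℕ) (j : ℕ) with hlt | heq | hgt
  · have h1 := of_allBelowN h j.isLt
    have h2 := of_allBelowN h1 hlt
    simpa using h2
  · rw [Fin.ext heq]
  · have h1 := of_allBelowN h i.isLt
    have h2 := of_allBelowN h1 hgt
    simp only [decide_eq_true_eq] at h2
    exact h2.symm

/-- `ballCheckQ` gives the real entrywise enclosure `|Q i j − N i j/den| ≤ rad/den`. [folklore] -/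
private theorem ball_of_ballCheckQ {n den rad : ℕ} {Q : List (List ℚ)} {N : List (List ℤ)} (hden : 0 < den)
    (h : ballCheckQ n den rad Q N = true) (i j : Fin n) :
    |((matrixOfRows n n Q).map (Rat.cast : ℚ → ℝ)) i j - ((N.getD i []).getD j 0 : ℝ) / den| ≤ (rad : ℝ) / den := by
  unfold ballCheckQ at h
  simp only [Bool.and_eq_true, decide_eq_true_eq] at h
  obtain ⟨-, hall⟩ := h
  have h1 := of_allBelowN hall i.isLt
  have h2 := of_allBelowN h1 j.isLt
  simp only [decide_eq_true_eq] at h2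
  have hden' : (0 : ℝ) < den := by exact_mod_cast hden
  have h3 : |(den : ℝ) * (((Q.getD i []).getD j 0 : ℚ) : ℝ) - ((N.getD i []).getD j 0 : ℝ)| ≤ (rad : ℝ) := by
    have := h2
    exact_mod_cast this
  simp only [Matrix.map_apply, matrixOfRows_apply]
  rw [show (((Q.getD i []).getD j 0 : ℚ) : ℝ) - ((N.getD i []).getD j 0 : ℝ) / den =
      ((den : ℝ) * (((Q.getD i []).getD j 0 : ℚ) : ℝ) - ((N.getD i []).getD j 0 : ℝ)) / den by field_simp]
  rw [abs_div, abs_of_pos hden']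
  exact div_le_div_of_nonneg_right h3 hden'.le

/-- **The exact rational member of a ball certificate**: `checkCertBall n den sA rad q r N R = true`, `Q` symmetric with
`|den·Q i j − N i j| ≤ rad` entrywise (both decided on the list data) ⇒ `Q − (q/(sA·den))·1 ⪰ 0` over `ℝ` — how a rational
Gram/moment block `Q` with large denominators is certified through a dyadic ball `N/den ± rad/den` around it.
[cite: Rump1999VerifiedLargeSystems, §4 Algorithm 4.1 steps 6–7 (PDF p. 243)] -/
theorem posSemidef_rat_of_checkCertBall {n den sA rad : ℕ} {q r : ℤ} {N R : List (List ℤ)} {Q : List (List ℚ)}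
    (h : checkCertBall n den sA rad q r N R = true) (hs : symmCheckQ n Q = true) (hQ : ballCheckQ n den rad Q N = true) :
    (((matrixOfRows n n Q).map (Rat.cast : ℚ → ℝ)) -
      ((q : ℝ) / ((sA : ℝ) * den)) • (1 : Matrix (Fin n) (Fin n) ℝ)).PosSemidef := by
  have hden : 0 < den := by
    have h' : 0 < den ∧ 0 < sA ∧ checkPsdMid n r ((sA : ℤ) * rad) (certMidRows sA q N) R = true := by
      simpa [checkCertBall, Bool.and_eq_true, decide_eq_true_eq, and_assoc] using h
    exact h'.1
  exact posSemidef_of_checkCertBall h (isSymm_of_symmCheckQ hs) (ball_of_ballCheckQ hden hQ)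

/-- **The exact rational member, row-band form.** [cite: Rump1999VerifiedLargeSystems, §4 Algorithm 4.1 steps 6–7 (PDF p. 243)] -/
theorem posSemidef_rat_ball_of_bands {n den sA rad : ℕ} {q r : ℤ} {N R : List (List ℤ)} {Q : List (List ℚ)}
    (hden : 0 < den) (hsA : 0 < sA) (hs : checkPsdShape n (certMidRows sA q N) R = true)
    (hb : ∀ t < n, ∃ i₀ k, checkPsdBand r ((sA : ℤ) * rad) (certMidRows sA q N) R i₀ k = true ∧ i₀ ≤ t ∧ t < i₀ + k)
    (hsy : symmCheckQ n Q = true) (hQ : ballCheckQ n den rad Q N = true) :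
    (((matrixOfRows n n Q).map (Rat.cast : ℚ → ℝ)) -
      ((q : ℝ) / ((sA : ℝ) * den)) • (1 : Matrix (Fin n) (Fin n) ℝ)).PosSemidef :=
  posSemidef_ball_of_bands hden hsA hs hb (isSymm_of_symmCheckQ hsy) (ball_of_ballCheckQ hden hQ)

/-- Test (exact rational member, `n = 2`): `Q = [[5/2, 3/2], [3/2, 11/4]]` lies within `rad/den = 1` of `N = [[3,1],[1,3]]`
(`den = 1`), so with the ball certificate below `Q + 3·1 ⪰ 0`. -/
example : (((matrixOfRows 2 2 [[(5 : ℚ) / 2, (3 : ℚ) / 2], [(3 : ℚ) / 2, (11 : ℚ) / 4]]).map (Rat.cast : ℚ → ℝ)) -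
      (((-3 : ℤ) : ℝ) / (((1 : ℕ) : ℝ) * (1 : ℕ))) • (1 : Matrix (Fin 2) (Fin 2) ℝ)).PosSemidef :=
  posSemidef_rat_of_checkCertBall (N := [[3, 1], [1, 3]]) (R := [[1], [0, 1]]) (rad := 1) (r := 4)
    (by decide +kernel) (by decide +kernel) (by decide +kernel)

/-- Test (ball form, `n = 2`): `N = [[3,1],[1,3]]`, `den = 1`, `sA = 1`, `rad = 1`, `q = −3`, `r = 4`, `R = [[1],[0,1]]`
(`E = N + 3·1 − 4·1 − RRᵀ = [[1,1],[1,1]]`, row budgets `2 + 2·1 = 4 ≤ 4`): every symmetric `A` within `1` of `N` entrywise has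
`A + 3·1 ⪰ 0` (e.g. `A = [[2,2],[2,2]]`, `λ_min = 0 ≥ −3`). -/
example : checkCertBall 2 1 1 1 (-3) 4 [[3, 1], [1, 3]] [[1], [0, 1]] = true := by
  decide +kernel

end Literature.Computation.Certificates.DyadicCholResidualKernel
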